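import Literature.AlgebraicGeometry.GroupSchemes.GroupSchemeActionStableAffineOpen
import Literature.AlgebraicGeometry.GroupSchemes.AffineGroupSchemeHopfAlgebra
import Mathlib.AlgebraicGeometry.Morphisms.Affine
import Mathlib.Algebra.Category.Ring.Constructions
import Mathlib.RingTheory.IsTensorProduct
import HarnessLib

/-!
# The chart of `pr₂ : G ×_S X → X` over an affine open: `Γ(pr₂⁻¹ V) = Γ(V) ⊗_{Γ(S)} Γ(G)` is finite free;
# stable affine neighbourhoods for an affine finite free group scheme (hypothesis-free head)

Layer `Literature/AlgebraicGeometry/GroupSchemes`, namespace `Literature.AlgebraicGeometry.GroupSchemes.ActionOrbit`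
(continuing ★ `GroupSchemeActionStableAffineOpen`).  This file DISCHARGES the chart hypothesis `hchart`
of ★ `exists_isAffineOpen_stable_of_orbit_subset`:

* `isPullback_chart_snd` ∕ `isPushout_chart_snd` — for `S` affine, `G → S` with `G` affine, any `X → S`
  and an affine open `V ⊆ X`: the square `pr₂⁻¹V → V → S ← G` is cartesian, so (Stacks 01JO, fibre
  products of affines) `Γ(S) → Γ(V), Γ(S) → Γ(G), pr₂^♯ : Γ(V) → Γ(pr₂⁻¹V), pr₁^♯ : Γ(G) → Γ(pr₂⁻¹V)` is a
  PUSHOUT of commutative rings (the `pr₂`-oriented twin of ★ `Morphisms.isPushout_chart`);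
* `moduleFree_moduleFinite_sections_preimage_snd` — hence if `Γ(G)` is finite free over `Γ(S)` then
  `Γ(pr₂⁻¹ V)` is finite free over `Γ(V)` through `pr₂^♯` (Mathlib `CommRingCat.isPushout_iff_isPushout`,
  `Algebra.IsPushout.equiv`);
* `exists_isAffineOpen_stable_of_orbit_subset_of_free` — **HYPOTHESIS-FREE HEAD** in the `SchemeOver R`
  currency of ★ `AffineGroupScheme.Alg`: for `G X : SchemeOver R`, `[GrpObj G] [ModObj G X]`, `G` affine
  with `G → Spec R` finite and `Alg G = Γ(G)` free over `R` (e.g. `R` local, `G → Spec R` finite flat), a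
  point whose orbit lies in an affine open `U ⊆ X` has a `G`-stable affine open neighbourhood `W ⊆ U`
  (Mumford, AV §12, proof of Thm. 1).

THEOREMS ONLY; no definition, no instance, no sorry.

## References
* [StacksProject] The Stacks project, Tag 01JO (fibre products of affine schemes).
* [MumfordAV1970] D. Mumford, *Abelian Varieties* (1970), §12 Thm. 1 (p. 111) and its proof (p. 112).
-/

noncomputable section

-- `TopCat.Presheaf` is not reducible (as in ★ `Morphisms.AffineBaseChangeChart`).
set_option backward.isDefEq.respectTransparency false

universe u

open CategoryTheory Limits MonoidalCategory CartesianMonoidalCategory AlgebraicGeometry TensorProduct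
open scoped MonObj

namespace Literature.AlgebraicGeometry.GroupSchemes.ActionOrbit

/-! ## §1 The chart square of `pr₂` over an affine open is cartesian; its rings form a pushout -/

section Chart

variable {S : Scheme.{u}} (G X : Over S)

/-- The chart square `pr₂⁻¹V → V → S ← G` (for `pr₂ : G ×_S X → X`) is cartesian. [cite: StacksProject, Tag 01JO] -/
theorem isPullback_chart_snd (V : X.left.Opens) :
    IsPullback ((snd G X).left ∣_ V) (((snd G X).left ⁻¹ᵁ V).ι ≫ (fst G X).left) (V.ι ≫ X.hom) G.hom := by
  rw [Over.snd_left, Over.fst_left]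
  exact (isPullback_morphismRestrict (pullback.snd G.hom X.hom) V).paste_vert
    (IsPullback.of_hasPullback G.hom X.hom).flip

variable [IsAffine S] [IsAffine G.left]

/-- **`Γ(pr₂⁻¹V, 𝒪) = Γ(V, 𝒪) ⊗_{Γ(S)} Γ(G, 𝒪)`** for `S`, `G` affine and an affine open `V ⊆ X`:
`IsPushout (Γ(S) → Γ(V)) (Γ(S) → Γ(G)) (pr₂^♯ : Γ(V) → Γ(pr₂⁻¹V)) (pr₁^♯ : Γ(G) → Γ(pr₂⁻¹V))`
(the `pr₂`-oriented twin of ★ `Morphisms.isPushout_chart`). [cite: StacksProject, Tag 01JO] -/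
theorem isPushout_chart_snd {V : X.left.Opens} (hV : IsAffineOpen V) :
    IsPushout (X.hom.appLE ⊤ V le_top) G.hom.appTop ((snd G X).left.app V)
      ((fst G X).left.appLE ⊤ ((snd G X).left ⁻¹ᵁ V) le_top) := by
  haveI : IsAffine (V : Scheme.{u}) := hV
  have h0 : IsPushout (V.ι ≫ X.hom).appTop G.hom.appTop ((snd G X).left ∣_ V).appTop
      (((snd G X).left ⁻¹ᵁ V).ι ≫ (fst G X).left).appTop :=
    isPushout_appTop_of_isPullback (isPullback_chart_snd G X V)
  refine h0.of_iso (Iso.refl _) V.topIso (Iso.refl _) ((snd G X).left ⁻¹ᵁ V).topIso ?_ ?_ ?_ ?_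
  · rw [Iso.refl_hom, Category.id_comp, Scheme.Hom.comp_appTop, Scheme.Opens.ι_appTop,
      Scheme.Opens.topIso_hom, Category.assoc]
    change X.hom.appLE ⊤ (V.ι ''ᵁ ⊤) le_top ≫ _ = _
    rw [Scheme.Hom.appLE_map]
  · simp only [Iso.refl_hom, Category.id_comp, Category.comp_id]
  · rw [Scheme.Opens.topIso_hom, Scheme.Opens.topIso_hom, morphismRestrict_appTop, Category.assoc,
      ← Functor.map_comp, Scheme.Hom.naturality]
    exact congrArg (fun k => (snd G X).left.app (V.ι ''ᵁ ⊤) ≫ (G ⊗ X).left.presheaf.map k)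
      (Quiver.Hom.unop_inj (Subsingleton.elim _ _))
  · rw [Iso.refl_hom, Category.id_comp, Scheme.Hom.comp_appTop, Scheme.Opens.ι_appTop,
      Scheme.Opens.topIso_hom, Category.assoc]
    change (fst G X).left.appLE ⊤ (((snd G X).left ⁻¹ᵁ V).ι ''ᵁ ⊤) le_top ≫ _ = _
    rw [Scheme.Hom.appLE_map]

/-- **`Γ(pr₂⁻¹ V)` is a finite free `Γ(V)`-module** (through `pr₂^♯`) whenever `Γ(G)` is a finite free
`Γ(S)`-module (through the structure map): `Γ(pr₂⁻¹ V) ≅ Γ(V) ⊗_{Γ(S)} Γ(G)` as `Γ(V)`-algebras. This is the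
chart hypothesis `hchart` of ★ `exists_isAffineOpen_stable_of_orbit_subset`. [cite: StacksProject, Tag 01JO] -/
theorem moduleFree_moduleFinite_sections_preimage_snd
    (hfree : letI := G.hom.appTop.hom.toAlgebra; Module.Free Γ(S, ⊤) Γ(G.left, ⊤))
    (hfin : letI := G.hom.appTop.hom.toAlgebra; Module.Finite Γ(S, ⊤) Γ(G.left, ⊤))
    {V : X.left.Opens} (hV : IsAffineOpen V) :
    letI := ((snd G X).left.app V).hom.toAlgebra
    Module.Free Γ(X.left, V) Γ((G ⊗ X).left, (snd G X).left ⁻¹ᵁ V) ∧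
      Module.Finite Γ(X.left, V) Γ((G ⊗ X).left, (snd G X).left ⁻¹ᵁ V) := by
  -- the four algebra structures of the pushout square and the composite
  letI i₁ : Algebra Γ(S, ⊤) Γ(X.left, V) := (X.hom.appLE ⊤ V le_top).hom.toAlgebra
  letI i₂ : Algebra Γ(S, ⊤) Γ(G.left, ⊤) := G.hom.appTop.hom.toAlgebra
  letI i₃ : Algebra Γ(X.left, V) Γ((G ⊗ X).left, (snd G X).left ⁻¹ᵁ V) := ((snd G X).left.app V).hom.toAlgebra
  letI i₄ : Algebra Γ(G.left, ⊤) Γ((G ⊗ X).left, (snd G X).left ⁻¹ᵁ V) :=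
    ((fst G X).left.appLE ⊤ ((snd G X).left ⁻¹ᵁ V) le_top).hom.toAlgebra
  letI i₅ : Algebra Γ(S, ⊤) Γ((G ⊗ X).left, (snd G X).left ⁻¹ᵁ V) :=
    (X.hom.appLE ⊤ V le_top ≫ (snd G X).left.app V).hom.toAlgebra
  have hP := isPushout_chart_snd G X hV
  haveI : IsScalarTower Γ(S, ⊤) Γ(X.left, V) Γ((G ⊗ X).left, (snd G X).left ⁻¹ᵁ V) :=
    IsScalarTower.of_algebraMap_eq' rfl
  haveI : IsScalarTower Γ(S, ⊤) Γ(G.left, ⊤) Γ((G ⊗ X).left, (snd G X).left ⁻¹ᵁ V) :=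
    IsScalarTower.of_algebraMap_eq' (congrArg CommRingCat.Hom.hom hP.w)
  have hA : Algebra.IsPushout Γ(S, ⊤) Γ(X.left, V) Γ(G.left, ⊤) Γ((G ⊗ X).left, (snd G X).left ⁻¹ᵁ V) :=
    CommRingCat.isPushout_iff_isPushout.mp hP
  let e := Algebra.IsPushout.equiv Γ(S, ⊤) Γ(X.left, V) Γ(G.left, ⊤) Γ((G ⊗ X).left, (snd G X).left ⁻¹ᵁ V)
  exact ⟨Module.Free.of_equiv e.toLinearEquiv, Module.Finite.equiv e.toLinearEquiv⟩

end Chart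

/-! ## §2 The hypothesis-free head over `Spec R` -/

section OverRing

open Literature.AlgebraicGeometry.Motives AffineGroupScheme

variable {R : Type u} [CommRing R] {G X : SchemeOver R} [GrpObj G] [ModObj G X] [IsAffine G.left]

omit [GrpObj G] [IsAffine G.left] in
/-- `Alg G` free (resp. finite free) over `R` ⇒ `Γ(G)` free (resp. finite) over `Γ(Spec R)` through `G → Spec R`
(the scalars differ by the isomorphism `R ≅ Γ(Spec R)`; Mathlib `Basis.mapCoeffs`). [cite: StacksProject, Tag 01JO] -/
theorem moduleFree_appTop_of_free [Module.Free R (Alg G)] [Module.Finite R (Alg G)] :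
    letI := G.hom.appTop.hom.toAlgebra
    Module.Free Γ(Spec (.of R), ⊤) Γ(G.left, ⊤) ∧ Module.Finite Γ(Spec (.of R), ⊤) Γ(G.left, ⊤) := by
  letI algΓ : Algebra Γ(Spec (.of R), ⊤) Γ(G.left, ⊤) := G.hom.appTop.hom.toAlgebra
  -- work on the `def` carrier `Alg G = Γ(G, ⊤)`, where the `R`-module structure lives
  letI algA : Algebra Γ(Spec (.of R), ⊤) (Alg G) :=
    (G.hom.appTop.hom : Γ(Spec (.of R), ⊤) →+* Alg G).toAlgebra
  let f : R ≃+* Γ(Spec (.of R), ⊤) := (Scheme.ΓSpecIso (.of R)).symm.commRingCatIsoToRingEquiv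
  have hf : ∀ (c : R) (x : Alg G), f c • x = c • x := fun _ _ => rfl
  let b := Module.Free.chooseBasis R (Alg G)
  let b' : Module.Basis (Module.Free.ChooseBasisIndex R (Alg G)) Γ(Spec (.of R), ⊤) (Alg G) :=
    b.mapCoeffs f hf
  exact ⟨Module.Free.of_basis b', Module.Finite.of_basis b'⟩

/-- **Stable affine neighbourhoods — hypothesis-free head (Mumford, AV §12, proof of Thm. 1).**  For `R`-schemes
`G X` with `[GrpObj G] [ModObj G X]`, `G` affine, `G → Spec R` finite and `Γ(G)` free over `R` (e.g. `R` local,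
`G` finite flat), if the orbit of a point `x` of `X` lies in an affine open `U`, then `x` has a `G`-STABLE AFFINE
open neighbourhood `W ⊆ U`.  (= ★ `exists_isAffineOpen_stable_of_orbit_subset` with `hchart` discharged by
`moduleFree_moduleFinite_sections_preimage_snd`.)  This is organ Q3 ∕ (r1) of the quotient-by-a-finite-flat-
subgroup-scheme road, hypothesis-free. [cite: MumfordAV1970, §12 proof of Thm. 1 (p. 112)] -/
theorem exists_isAffineOpen_stable_of_orbit_subset_of_free [IsFinite G.hom] [Module.Free R (Alg G)]
    (x : X.left) (U : X.left.Opens) (hU : IsAffineOpen U)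
    (horb : ∀ p : ↑(G ⊗ X).left, (snd G X).left p = x → (γ[G, X]).left p ∈ U) :
    ∃ W : X.left.Opens, IsAffineOpen W ∧ x ∈ W ∧ W ≤ U ∧
      ∀ p : ↑(G ⊗ X).left, (snd G X).left p ∈ W → (γ[G, X]).left p ∈ W := by
  haveI : Module.Finite R (Alg G) := Alg.moduleFinite G
  haveI : IsFinite (snd G X).left := isFinite_snd_left
  obtain ⟨hfree, hfin⟩ := moduleFree_appTop_of_free (G := G)
  exact exists_isAffineOpen_stable_of_orbit_subset
    (fun V hV => moduleFree_moduleFinite_sections_preimage_snd G X hfree hfin hV) x U hU horb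

/-- **`G`-stable affine cover — the `hcov` input of the §Q junction, hypothesis-free** (Mumford AV §12 Thm. 1's
hypothesis «every orbit lies in an affine open», here from «every finite set of points lies in an affine open»
since orbits are finite): for `G X : SchemeOver R` with `[GrpObj G] [ModObj G X]`, `G` affine, `G → Spec R` finite,
`Γ(G)` free over `R`, every point of `X` lies in an affine open `W` that is `G`-stable in the currency of ★
`ActionRestrict.liftOpen` (`σ(G ×_S W) ⊆ W`). [cite: MumfordAV1970, §12 Thm. 1 (p. 111)] -/
theorem forall_exists_stable_isAffineOpen_of_free [IsFinite G.hom] [Module.Free R (Alg G)]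
    (hfin : ∀ F : Finset X.left, ∃ U : X.left.Opens, IsAffineOpen U ∧ ∀ x ∈ F, x ∈ U) (x : X.left) :
    ∃ W : X.left.Opens, x ∈ W ∧ IsAffineOpen W ∧
      Set.range ((G ◁ (Over.homMk W.ι rfl : Over.mk (W.ι ≫ X.hom) ⟶ X)) ≫ γ[G, X]).left ⊆ (W : Set X.left) := by
  classical
  haveI : IsFinite (snd G X).left := isFinite_snd_left
  -- the orbit of `x` is finite, hence inside an affine open
  have hfib : ((snd G X).left ⁻¹' {x}).Finite := (snd G X).left.finite_preimage_singleton x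
  obtain ⟨U, hU, hxU⟩ := hfin (hfib.image (γ[G, X]).left).toFinset
  have horb : ∀ p : ↑(G ⊗ X).left, (snd G X).left p = x → (γ[G, X]).left p ∈ U :=
    fun p hp => hxU _ ((Set.Finite.mem_toFinset _).mpr ⟨p, hp, rfl⟩)
  obtain ⟨W, hW, hxW, -, hstab⟩ := exists_isAffineOpen_stable_of_orbit_subset_of_free x U hU horb
  refine ⟨W, hxW, hW, ?_⟩
  rintro _ ⟨p, rfl⟩
  rw [Over.comp_left, Scheme.Hom.comp_apply]
  apply hstab
  rw [← Scheme.Hom.comp_apply, ← Over.comp_left, whiskerLeft_snd, Over.comp_left, Scheme.Hom.comp_apply]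
  exact (((snd G (Over.mk (W.ι ≫ X.hom))).left p) : ↥W).2

end OverRing

end Literature.AlgebraicGeometry.GroupSchemes.ActionOrbit

end
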